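import Summits.KontsevichZagierPeriods.KontsevichZagierPeriods.Theorems.AbelContractionRealHyperellipticSectorStubEulerKit
import Summits.KontsevichZagierPeriods.KontsevichZagierPeriods.Theorems.HermiteRigidityGenusTwoCycleTransferSemialgebraicInvFunOn
import Mathlib.Analysis.SpecialFunctions.Sqrt
import HarnessLib

/-!
# `RealOnePeriodRelations` (stmt-KontsevichZagierPeriods-10042), line `nash-retraction-thin-strip`,
# the conic layer: the stub `stub_eulerLeadCell`

`ConicLayer.stub_eulerLeadCell`: EULER'S FIRST SUBSTITUTION as ONE instance of Kontsevich–Zagier's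
rule (2) in dimension one.  Data: a real algebraic quadratic `q(x) = αx² + βx + γ` with `α > 0` and
`β² − 4αγ ≠ 0`, positive on `[a, b]` (`a < b` real algebraic), and a representation `r` on the slab
`{z | z 0 ∈ (a, b)}` with integrand `P(x)/(Q(x)·√q(x))`, `P, Q ∈ K[X]`, `K = algebraicClosure ℚ ℝ`
the real algebraic numbers, `Q ≠ 0` on `[a, b]`.

The chart is `φ(x) = √q(x) + s·x`, `s = √α` (real algebraic), with derivative
`φ′(x) = (2αx + β)/(2√q(x)) + s = g(x)/(2√q(x))`, `g(x) = 2αx + β + 2s√q(x) = β + 2s·φ(x)`.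
The key point: `g ≠ 0` on `[a, b]`, since `g(x) = 0` forces `(2αx + β)² = 4α·q(x)`, i.e.
`β² − 4αγ = 0`.  Hence (`g` continuous on the connected `[a, b]`) `|g| = σ·g` for a constant sign
`σ = ±1`, `φ′ ≠ 0`, and `φ` has the `K`-rational left inverse `ψ(t) = (t² − γ)/(β + 2st)` on
`[a, b]` (`β + 2s·φ(x) = g(x) ≠ 0`), so `φ` is injective and continuous on `[a, b]`, strictly
monotone, and maps `(a, b)` onto the open interval with end points `φ(a)`, `φ(b)` — real algebraic
numbers.  The push-forward representation `r′` is BUILT by the landed one-dimensional rule-2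
push-forward `HermiteRigidity.GenusTwoCycleTransfer.stub_pushforwardDimOne` (domain the image,
integrand `(r.integrand/|φ′|) ∘ Φ⁻¹`, integrability by Mathlib's change-of-variables criterion) with
the semialgebraic inverse of `…stub_semialgebraicInvFunOn`; its integrand at `t = φ(x)` is
`P(x)/(Q(x)√q(x)) · 2√q(x)/(σ·g(x)) = 2·P(ψ t)/(Q(ψ t)·σ·(β + 2st))`, a `K`-rational function of
`t` (closure of `K`-rational functions under the field operations and substitution into a
`K`-polynomial, `AbelContraction.RealHyperellipticSector.Euler.krat_*`).  The relation produced is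
literally an element of `KZ.changeOfVariablesRel`.

References: M. Kontsevich, D. Zagier, *Periods* (2001), §1.2 rule (2); L. Euler, *Institutiones
calculi integralis* I (1768), §§ 88–99; J. Bochnak, M. Coste, M.-F. Roy, *Real Algebraic Geometry*
(1998), §2.2.  No definitions are introduced.
-/

noncomputable section

open scoped BigOperators Polynomial
open Set MeasureTheory MvPolynomial
open Literature.NumberTheory.Transcendental
open Literature.ModelTheory.ExponentialFields (IsSemialgebraic)
open Summit.KontsevichZagierPeriods.AbelContraction.RealHyperellipticSector.Euler
  (krat_const krat_id krat_congr krat_add krat_mul krat_div krat_sub krat_pow isAlgebraic_sqrt)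
open Summit.KontsevichZagierPeriods.HurwitzMicroSectors.NormalFormPrinciple.PiBox.AlgSplitK5
  (isAlgebraic_coeK)
open Summit.KontsevichZagierPeriods.HermiteRigidity.GenusTwoCycleTransfer
  (stub_pushforwardDimOne stub_semialgebraicInvFunOn)

namespace Summit.KontsevichZagierPeriods.SymplecticScissors.RealOnePeriodRelations.ConicLayer

/-- A `K`-polynomial (`K = algebraicClosure ℚ ℝ`) of a `K`-rational function on `T ⊆ ℝ` is
`K`-rational on `T` (induction on the polynomial; each coefficient is a real algebraic constant).
[cite: KontsevichZagier2001, §1.2 (rule 2)] -/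
theorem eulerLeadCell_krat_aevalK {T : Set ℝ} {f : ℝ → ℝ} (A : (algebraicClosure ℚ ℝ)[X])
    (hf : ∃ P Q : (algebraicClosure ℚ ℝ)[X], ∀ t ∈ T, (Polynomial.aeval t Q : ℝ) ≠ 0 ∧
      f t = (Polynomial.aeval t P : ℝ) / (Polynomial.aeval t Q : ℝ)) :
    ∃ P Q : (algebraicClosure ℚ ℝ)[X], ∀ t ∈ T, (Polynomial.aeval t Q : ℝ) ≠ 0 ∧
      (fun s => (Polynomial.aeval (f s) A : ℝ)) t =
        (Polynomial.aeval t P : ℝ) / (Polynomial.aeval t Q : ℝ) := by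
  induction A using Polynomial.induction_on' with
  | add p q hp hq => exact krat_congr (krat_add hp hq) fun t _ => by simp
  | monomial n c =>
    refine krat_congr (krat_mul (krat_const T (isAlgebraic_coeK c)) (krat_pow hf n)) fun t _ => ?_
    simp [Polynomial.aeval_monomial]

/-- A real function continuous and nowhere zero on `[a, b]` has constant sign there: `|g| = σ·g` on
`[a, b]` for a real algebraic constant `σ ≠ 0` (`σ = ±1`; intermediate values on the connected
`[a, b]`). [cite: KontsevichZagier2001, §1.2 (rule 2)] -/
theorem eulerLeadCell_sign {g : ℝ → ℝ} {a b : ℝ} (hab : a ≤ b) (hg : ContinuousOn g (Icc a b))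
    (h0 : ∀ x ∈ Icc a b, g x ≠ 0) :
    ∃ σ : ℝ, IsAlgebraic ℚ σ ∧ σ ≠ 0 ∧ ∀ x ∈ Icc a b, |g x| = σ * g x := by
  have hpre : (g '' Icc a b).OrdConnected :=
    isPreconnected_iff_ordConnected.mp (isPreconnected_Icc.image g hg)
  have ha : a ∈ Icc a b := left_mem_Icc.2 hab
  rcases lt_or_gt_of_ne (h0 a ha) with hneg | hpos
  · refine ⟨-1, isAlgebraic_one.neg, by norm_num, fun x hx => ?_⟩
    have hx0 : g x < 0 := by
      by_contra h
      obtain ⟨c, hc, hc0⟩ := hpre.out ⟨a, ha, rfl⟩ ⟨x, hx, rfl⟩ ⟨hneg.le, not_lt.mp h⟩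
      exact h0 c hc hc0
    rw [abs_of_neg hx0]
    ring
  · refine ⟨1, isAlgebraic_one, one_ne_zero, fun x hx => ?_⟩
    have hx0 : 0 < g x := by
      by_contra h
      obtain ⟨c, hc, hc0⟩ := hpre.out ⟨x, hx, rfl⟩ ⟨a, ha, rfl⟩ ⟨not_lt.mp h, hpos.le⟩
      exact h0 c hc hc0
    rw [abs_of_pos hx0, one_mul]

/-- A function continuous and injective on `[a, b]`, `a < b`, is strictly monotone there and maps
`(a, b)` onto the open interval with end points `φ a`, `φ b` (intermediate values).
[cite: KontsevichZagier2001, §1.2 (rule 2)] -/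
theorem eulerLeadCell_image_Ioo {φ : ℝ → ℝ} {a b : ℝ} (hab : a < b)
    (hc : ContinuousOn φ (Icc a b)) (hinj : InjOn φ (Icc a b)) :
    ∃ a' b' : ℝ, (a' = φ a ∧ b' = φ b ∨ a' = φ b ∧ b' = φ a) ∧ a' < b' ∧
      φ '' Ioo a b = Ioo a' b' := by
  have ha : a ∈ Icc a b := left_mem_Icc.2 hab.le
  have hb : b ∈ Icc a b := right_mem_Icc.2 hab.le
  rcases hc.strictMonoOn_of_injOn_Icc' hab.le hinj with hmono | hanti
  · refine ⟨φ a, φ b, Or.inl ⟨rfl, rfl⟩, hmono ha hb hab,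
      Subset.antisymm ?_ (intermediate_value_Ioo hab.le hc)⟩
    rintro _ ⟨x, hx, rfl⟩
    exact ⟨hmono ha (Ioo_subset_Icc_self hx) hx.1, hmono (Ioo_subset_Icc_self hx) hb hx.2⟩
  · refine ⟨φ b, φ a, Or.inr ⟨rfl, rfl⟩, hanti ha hb hab,
      Subset.antisymm ?_ (intermediate_value_Ioo' hab.le hc)⟩
    rintro _ ⟨x, hx, rfl⟩
    exact ⟨hanti (Ioo_subset_Icc_self hx) hb hx.2, hanti ha (Ioo_subset_Icc_self hx) hx.1⟩

/-- STUB `stub_eulerLeadCell` — **Euler's first substitution as ONE instance of rule (2).**  For a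
real algebraic quadratic `q = αx² + βx + γ` with `α > 0` and non-zero discriminant, positive on
`[a, b]` (`a < b` real algebraic), and an integrand `P(x)/(Q(x)·√q(x))` (`P, Q` real algebraic
polynomials, `Q ≠ 0` on `[a, b]`), Euler's substitution `t = √q(x) + √α·x`
(`x = ψ(t) = (t² − γ)/(β + 2√α·t)`, a semialgebraic `C¹` diffeomorphism of `(a, b)` onto a bounded
interval with real algebraic end points, never singular on the arc since
`(2αx + β + 2√α√q)·(2αx + β − 2√α√q) = β² − 4αγ ≠ 0`) turns the representation into one with a
RATIONAL integrand `2P(ψ t)/(σ·Q(ψ t)·(β + 2√α·t))` with real algebraic coefficients (`σ = ±1` the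
constant sign of `2αx + β + 2√α√q` on `[a, b]`): `[r] − [r′] ∈ (2)`, the push-forward `r′` being
built by `HermiteRigidity.GenusTwoCycleTransfer.stub_pushforwardDimOne`.
[cite: KontsevichZagier2001, §1.2 (rule 2)] -/
theorem stub_eulerLeadCell (α β γ a b : ℝ) (hα : IsAlgebraic ℚ α) (hβ : IsAlgebraic ℚ β) (hγ : IsAlgebraic ℚ γ)
    (ha : IsAlgebraic ℚ a) (hb : IsAlgebraic ℚ b) (hab : a < b) (hα0 : 0 < α) (hdisc : β ^ 2 - 4 * α * γ ≠ 0)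
    (hpos : ∀ x ∈ Set.Icc a b, 0 < α * x ^ 2 + β * x + γ) (P Q : Polynomial (algebraicClosure ℚ ℝ))
    (hQ : ∀ x ∈ Set.Icc a b, Polynomial.aeval x Q ≠ 0)
    (r : KZ.IntegralRep 1) (hdom : r.domain = {z | z 0 ∈ Set.Ioo a b})
    (hint : ∀ z ∈ r.domain, r.integrand z =
      Polynomial.aeval (z 0) P / (Polynomial.aeval (z 0) Q * Real.sqrt (α * (z 0) ^ 2 + β * (z 0) + γ))) :
    ∃ r' : KZ.IntegralRep 1,
      (∃ a' b' : ℝ, IsAlgebraic ℚ a' ∧ IsAlgebraic ℚ b' ∧ a' < b' ∧ r'.domain = {z | z 0 ∈ Set.Ioo a' b'} ∧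
        ∃ P' Q' : Polynomial (algebraicClosure ℚ ℝ), (∀ t ∈ Set.Ioo a' b', Polynomial.aeval t Q' ≠ 0) ∧
          ∀ t ∈ Set.Ioo a' b', r'.integrand (fun _ => t) = Polynomial.aeval t P' / Polynomial.aeval t Q') ∧
      KZ.of r - KZ.of r' ∈ KZ.changeOfVariablesRel := by
  -- the quadratic `q`, the real algebraic `s = √α`
  obtain ⟨q, hq⟩ : ∃ q : ℝ → ℝ, ∀ x, q x = α * x ^ 2 + β * x + γ := ⟨_, fun _ => rfl⟩
  have hposq : ∀ x ∈ Icc a b, 0 < q x := fun x hx => by rw [hq]; exact hpos x hx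
  have hsq : ∀ x ∈ Icc a b, 0 < √(q x) := fun x hx => Real.sqrt_pos.mpr (hposq x hx)
  have hs2q : ∀ x ∈ Icc a b, √(q x) * √(q x) = α * x ^ 2 + β * x + γ := fun x hx => by
    rw [Real.mul_self_sqrt (hposq x hx).le, hq]
  obtain ⟨s, hs2, hsA⟩ : ∃ s : ℝ, s * s = α ∧ IsAlgebraic ℚ s :=
    ⟨√α, Real.mul_self_sqrt hα0.le, isAlgebraic_sqrt hα⟩
  have h2A : IsAlgebraic ℚ (2 : ℝ) := by simpa using isAlgebraic_nat (R := ℚ) (A := ℝ) 2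
  -- `g = 2αx + β + 2s√q` does not vanish on `[a, b]`: `g = 0` forces `β² = 4αγ`
  obtain ⟨g, hg⟩ : ∃ g : ℝ → ℝ, ∀ x, g x = 2 * α * x + β + 2 * s * √(q x) := ⟨_, fun _ => rfl⟩
  have hg0 : ∀ x ∈ Icc a b, g x ≠ 0 := fun x hx h => by
    rw [hg] at h
    apply hdisc
    linear_combination (2 * α * x + β - 2 * s * √(q x)) * h + 4 * √(q x) ^ 2 * hs2 +
      4 * α * hs2q x hx
  -- hence `g` has a constant sign `σ` on `[a, b]`
  have hqc : Continuous q := by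
    rw [show q = fun x => α * x ^ 2 + β * x + γ from funext hq]
    fun_prop
  have hgc : Continuous g := by
    rw [show g = fun x => 2 * α * x + β + 2 * s * √(q x) from funext hg]
    fun_prop
  obtain ⟨σ, hσA, hσ0, hσg⟩ := eulerLeadCell_sign hab.le hgc.continuousOn hg0
  -- the chart `φ = √q + s·x`, its derivative `φ'`, its rational left inverse `ψ`
  obtain ⟨φ, hφ⟩ : ∃ φ : ℝ → ℝ, ∀ x, φ x = √(q x) + s * x := ⟨_, fun _ => rfl⟩
  obtain ⟨φ', hφ'⟩ : ∃ φ' : ℝ → ℝ, ∀ x, φ' x = (2 * α * x + β) / (2 * √(q x)) + s :=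
    ⟨_, fun _ => rfl⟩
  obtain ⟨ψ, hψ⟩ : ∃ ψ : ℝ → ℝ, ∀ t, ψ t = (t ^ 2 - γ) / (β + 2 * s * t) := ⟨_, fun _ => rfl⟩
  have hgφ : ∀ x, β + 2 * s * φ x = g x := fun x => by
    rw [hφ, hg]
    linear_combination (2 * x) * hs2
  have hψφ : ∀ x ∈ Icc a b, ψ (φ x) = x := fun x hx => by
    rw [hψ, hgφ x, div_eq_iff (hg0 x hx), hφ, hg]
    linear_combination hs2q x hx + x ^ 2 * hs2
  have hinj : InjOn φ (Icc a b) := fun x hx y hy h => by rw [← hψφ x hx, ← hψφ y hy, h]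
  have hq' : ∀ x, HasDerivAt q (2 * α * x + β) x := fun x => by
    rw [show q = fun y => α * y ^ 2 + β * y + γ from funext hq]
    refine ((((hasDerivAt_pow 2 x).const_mul α).add ((hasDerivAt_id' x).const_mul β)).add_const
      γ).congr_deriv ?_
    simp
    ring
  have hder : ∀ x ∈ Icc a b, HasDerivAt φ (φ' x) x := fun x hx => by
    rw [show φ = fun y => √(q y) + s * y from funext hφ, hφ']
    exact (((hq' x).sqrt (hposq x hx).ne').add ((hasDerivAt_id' x).const_mul s)).congr_deriv
      (by rw [mul_one])
  have hcont : ContinuousOn φ (Icc a b) := fun x hx => (hder x hx).continuousAt.continuousWithinAt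
  have hφ'eq : ∀ x ∈ Icc a b, φ' x = g x / (2 * √(q x)) := fun x hx => by
    rw [hφ', hg]
    have h1 := (hsq x hx).ne'
    field_simp
  have hne : ∀ x ∈ Icc a b, φ' x ≠ 0 := fun x hx => by
    rw [hφ'eq x hx]
    exact div_ne_zero (hg0 x hx) (mul_ne_zero two_ne_zero (hsq x hx).ne')
  have habsφ' : ∀ x ∈ Icc a b, |φ' x| = σ * g x / (2 * √(q x)) := fun x hx => by
    rw [hφ'eq x hx, abs_div, abs_of_pos (mul_pos two_pos (hsq x hx)), hσg x hx]
  -- the image interval `(a', b')`, with real algebraic end points `φ a`, `φ b`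
  obtain ⟨a', b', hab', hlt', himφ⟩ := eulerLeadCell_image_Ioo hab hcont hinj
  have hφA : ∀ {x : ℝ}, IsAlgebraic ℚ x → IsAlgebraic ℚ (φ x) := fun {x} hx => by
    rw [hφ, hq]
    exact (isAlgebraic_sqrt (((hα.mul (hx.pow 2)).add (hβ.mul hx)).add hγ)).add (hsA.mul hx)
  have ha'A : IsAlgebraic ℚ a' ∧ IsAlgebraic ℚ b' := by
    rcases hab' with ⟨rfl, rfl⟩ | ⟨rfl, rfl⟩
    exacts [⟨hφA ha, hφA hb⟩, ⟨hφA hb, hφA ha⟩]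
  have hT : ∀ t ∈ Ioo a' b', ∃ x ∈ Ioo a b, φ x = t := fun t ht => by
    rw [← himφ] at ht
    exact ht
  -- bookkeeping on the slab `r.domain = {p | p 0 ∈ (a, b)}`
  have hmem : ∀ p, p ∈ r.domain ↔ p 0 ∈ Ioo a b := fun p => by rw [hdom]; rfl
  have hmem' : ∀ p ∈ r.domain, p 0 ∈ Icc a b := fun p hp => Ioo_subset_Icc_self ((hmem p).1 hp)
  have heq1 : ∀ p : Fin 1 → ℝ, (fun _ : Fin 1 => p 0) = p := fun p => by
    funext i
    rw [Fin.fin_one_eq_zero i]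
  have hσr := r.isSemialgebraic_domain
  -- `φ`, `φ'` are `ℚ`-semialgebraic functions of the coordinate on the slab
  have hx0 : IsSemialgebraicFunOn ℚ r.domain (fun p : Fin 1 → ℝ => p 0) := by
    simpa using isSemialgebraicFunOn_aeval hσr (MvPolynomial.X 0 : MvPolynomial (Fin 1) ℚ)
  have haS := isSemialgebraicFunOn_const_of_isAlgebraic hσr hα
  have hbS := isSemialgebraicFunOn_const_of_isAlgebraic hσr hβ
  have hsS := isSemialgebraicFunOn_const_of_isAlgebraic hσr hsA
  have hqsa : IsSemialgebraicFunOn ℚ r.domain (fun p => q (p 0)) :=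
    (((haS.fun_mul (hx0.fun_pow 2)).fun_add (hbS.fun_mul hx0)).fun_add
      (isSemialgebraicFunOn_const_of_isAlgebraic hσr hγ)).congr fun p _ => (hq (p 0)).symm
  have hφs : IsSemialgebraicFunOn ℚ r.domain (fun p => φ (p 0)) :=
    (hqsa.fun_sqrt.fun_add (hsS.fun_mul hx0)).congr fun p _ => (hφ (p 0)).symm
  have hφ's : IsSemialgebraicFunOn ℚ r.domain (fun p => φ' (p 0)) :=
    ((((((isSemialgebraicFunOn_const_ofNat hσr 2).fun_mul haS).fun_mul hx0).fun_add hbS).div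
        ((isSemialgebraicFunOn_const_ofNat hσr 2).fun_mul hqsa.fun_sqrt)
        (fun p hp => mul_ne_zero two_ne_zero (hsq _ (hmem' p hp)).ne')).fun_add hsS).congr
      fun p _ => (hφ' (p 0)).symm
  -- the push-forward of `r` along `Φ p = (φ (p 0))` (rule 2)
  have hΦsa : IsSemialgebraicMapOn ℚ r.domain (fun p : Fin 1 → ℝ => fun _ : Fin 1 => φ (p 0)) :=
    IsSemialgebraicMapOn.of_forall hσr fun _ => hφs
  have hinjΦ : InjOn (fun p : Fin 1 → ℝ => fun _ : Fin 1 => φ (p 0)) r.domain := by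
    intro p hp p' hp' h
    have h1 : φ (p 0) = φ (p' 0) := congrFun h 0
    rw [← heq1 p, ← heq1 p', hinj (hmem' p hp) (hmem' p' hp') h1]
  have hG := stub_semialgebraicInvFunOn hΦsa hinjΦ
  obtain ⟨r', hr'd, hr'i, hrel⟩ := stub_pushforwardDimOne r φ φ' _ hφs hφ's
    (fun p hp => hder _ (hmem' p hp)) (fun p hp => hne _ (hmem' p hp)) hG
    (fun p hp => hinjΦ.leftInvOn_invFunOn hp)
  have himg : (fun p : Fin 1 → ℝ => fun _ : Fin 1 => φ (p 0)) '' r.domain =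
      {p | p 0 ∈ Ioo a' b'} := by
    rw [← himφ]
    ext p'
    simp only [mem_image, mem_setOf_eq]
    constructor
    · rintro ⟨p, hp, rfl⟩
      exact ⟨p 0, (hmem p).1 hp, rfl⟩
    · rintro ⟨x, hx, hx'⟩
      refine ⟨fun _ => x, (hmem _).2 hx, ?_⟩
      rw [← heq1 p']
      funext
      exact hx'
  -- the new integrand `F(t) = 2P(ψ t)/(Q(ψ t)·σ·(β + 2st))` is `K`-rational on `(a', b')`
  have hden : ∀ t ∈ Ioo a' b', β + 2 * s * t ≠ 0 := fun t ht => by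
    obtain ⟨x, hx, rfl⟩ := hT t ht
    rw [hgφ]
    exact hg0 x (Ioo_subset_Icc_self hx)
  have hψT : ∀ t ∈ Ioo a' b', ψ t ∈ Icc a b := fun t ht => by
    obtain ⟨x, hx, rfl⟩ := hT t ht
    rw [hψφ x (Ioo_subset_Icc_self hx)]
    exact Ioo_subset_Icc_self hx
  have hψk : ∃ P₁ Q₁ : (algebraicClosure ℚ ℝ)[X], ∀ t ∈ Ioo a' b',
      (Polynomial.aeval t Q₁ : ℝ) ≠ 0 ∧
        ψ t = (Polynomial.aeval t P₁ : ℝ) / (Polynomial.aeval t Q₁ : ℝ) :=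
    krat_congr (krat_div (krat_sub (krat_pow (krat_id _) 2) (krat_const _ hγ))
      (krat_add (krat_const _ hβ) (krat_mul (krat_mul (krat_const _ h2A) (krat_const _ hsA))
        (krat_id _))) hden) fun t _ => (hψ t).symm
  have hQT : ∀ t ∈ Ioo a' b', (Polynomial.aeval (ψ t) Q : ℝ) ≠ 0 := fun t ht => hQ _ (hψT t ht)
  have hσT : ∀ t ∈ Ioo a' b', σ * (β + 2 * s * t) ≠ 0 := fun t ht =>
    mul_ne_zero hσ0 (hden t ht)
  obtain ⟨F, hF⟩ : ∃ F : ℝ → ℝ, ∀ t, F t = 2 * (Polynomial.aeval (ψ t) P : ℝ) /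
      ((Polynomial.aeval (ψ t) Q : ℝ) * (σ * (β + 2 * s * t))) := ⟨_, fun _ => rfl⟩
  obtain ⟨P', Q', hPQ'⟩ : ∃ P' Q' : (algebraicClosure ℚ ℝ)[X], ∀ t ∈ Ioo a' b',
      (Polynomial.aeval t Q' : ℝ) ≠ 0 ∧
        F t = (Polynomial.aeval t P' : ℝ) / (Polynomial.aeval t Q' : ℝ) :=
    krat_congr (krat_div (krat_mul (krat_const _ h2A) (eulerLeadCell_krat_aevalK P hψk))
      (krat_mul (eulerLeadCell_krat_aevalK Q hψk) (krat_mul (krat_const _ hσA)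
        (krat_add (krat_const _ hβ) (krat_mul (krat_mul (krat_const _ h2A) (krat_const _ hsA))
          (krat_id _)))))
      fun t ht => mul_ne_zero (hQT t ht) (hσT t ht)) fun t _ => (hF t).symm
  -- assembling
  refine ⟨r', ⟨a', b', ha'A.1, ha'A.2, hlt', hr'd.trans himg, P', Q', fun t ht => (hPQ' t ht).1,
    fun t ht => ?_⟩, hrel⟩
  obtain ⟨x, hx, rfl⟩ := hT t ht
  have hxI : x ∈ Icc a b := Ioo_subset_Icc_self hx
  have hp : (fun _ : Fin 1 => x) ∈ r.domain := (hmem _).2 hx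
  have key : r'.integrand (fun _ => φ x) = r.integrand (fun _ => x) / |φ' x| := hr'i _ hp
  have key' : r.integrand (fun _ => x) = (Polynomial.aeval x P : ℝ) /
      ((Polynomial.aeval x Q : ℝ) * √(α * x ^ 2 + β * x + γ)) := hint _ hp
  rw [← (hPQ' _ ht).2, hF, key, key', hψφ x hxI, hgφ x, habsφ' x hxI, ← hq x]
  have h1 := (hsq x hxI).ne'
  have h2 := hQ x hxI
  have h3 := hg0 x hxI
  field_simp

end Summit.KontsevichZagierPeriods.SymplecticScissors.RealOnePeriodRelations.ConicLayer

end
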